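import Literature.AnabelianGeometry.AbsoluteAnabelian.AbsTopIProp410TemperedModelPrelims
import Literature.AnabelianGeometry.SemiGraphs.TemperedFibreProduct
import HarnessLib

/-!
# [AbsTopI] Prop 4.10 (iii): the co-free core of `Γ × 1 ≤ (P ×_Z ℤ) × G` is the compact slice
# `Ker(pr_ℤ) × 1` — "the dual graph of the fibre-product model is ONE LOOP" (proof-only)

S. Mochizuki, *Topics in Absolute Anabelian Geometry I: Generalities* [AbsTopI] (2012), §0 p. 8
("we shall refer to a normal open subgroup `H ⊆ G` such that the quotient group `G/H` is a free
discrete group as co-free [...] minimal if every co-free subgroup of `G` contains `H`"), p. 60 l. 8–13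
("`H ↠ H/H^{co-fr}` corresponds to the tempered covering [...] determined by the universal covering of
the dual graph of the special fiber"); manuscript pagination, lit key `paper:url-11ac98ba15fc`, read
on the page.  S. Mochizuki, *Semi-graphs of anabelioids* [SemiAnbd] Def 3.1 (i) p. 33 / Ex 3.10
pp. 43–45 / [EtTh] §1 p. 12 ("the natural surjection `Π^tp_X ↠ Z`"): abc-iut-w5-d218's fibre-product
tempered models `Γ = P ×_Z ℤ` (`TemperedFibreProduct*.lean`).

Context: ingredients of the NON-compact tempered model of the companion
`AbsTopIProp410TemperedModelSchemaNegative.lean` (node AbsTopI:Prop4.10(iii) of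
`HOME/plan/L4/SUBDAG-AbsTopI-Prop410.md`).  For the fibre product `Γ = P ×_Z ℤ` (`P` profinite, `Z`
Hausdorff, `(x, n) ∈ Γ ↔ e x = ι n`, `pr_ℤ : Γ ↠ ℤ` onto) and ANY topological group `G`:
* `isCompact_ker_snd` — the slice `Γ₀ := Ker(pr_ℤ) = (Ker e × 0) ∩ Γ` is compact;
* `cofreeCore_top_prod_bot` — inside `Γ × G`, the co-free core of `Δ := Γ × 1` is `Γ₀ × 1`: it is
  co-free in `Δ` (open — the slice is open —, normal, quotient `Δ/(Γ₀ × 1) ≅ ℤ` free) and compact,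
  hence minimal co-free (`isMinimalCofreeIn_of_isCompact`), i.e. `Δ^{co-fr} = Γ₀ × 1` of INFINITE index
  (the one-loop dual graph of the once-punctured Tate curve that the model imitates);
* `CharOpenSubgroup.exists_eq_self` — `Δ` itself is an index of the §0 completion;
* `not_compactSpace_of_continuous_surjective_int` — a space mapping continuously ONTO the discrete `ℤ`
  is not compact.
Hypothesis-parametrised, PROOF-ONLY (no `def`, no instance, no named fact; FACT-LIST untouched).
HONEST FRAMING: classical topology/group theory; refereed prerequisite papers; nothing here bears on
[IUTchIII] Cor 3.12; typed ≠ proved.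
-/

noncomputable section

open _root_.Topology _root_.Filter _root_.Set _root_.Function

/-! ### Generic helpers -/

namespace Literature.AnabelianGeometry.AbsoluteAnabelian.AbsTopI

variable {P : Type*} [Group P] [TopologicalSpace P]

/-- `Δ` itself is a characteristic open subgroup of finite index of `Δ` (an index of the §0
completion). [cite: MochizukiAbsTopI2012, §0 p.8] -/
theorem CharOpenSubgroup.exists_eq_self [IsTopologicalGroup P] (Δ : Subgroup P) :
    ∃ H : CharOpenSubgroup Δ, H.toSubgroup = Δ := by
  have htop : Δ.subgroupOf Δ = ⊤ := Subgroup.subgroupOf_self Δ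
  refine ⟨⟨Δ, le_rfl, ?_, ?_, fun α => ?_⟩, rfl⟩
  · rw [htop]; exact isOpen_univ
  · rw [htop]; infer_instance
  · rw [htop]; exact Subgroup.map_top_of_surjective _ α.surjective

/-- A space mapping continuously ONTO the discrete group `ℤ` is not compact — the obstruction to
compactness carried by the discrete quotient "`Π^tp_X ↠ Z`" of the tempered models of [SemiAnbd]
Ex. 3.10 / [EtTh] §1 p. 12. [cite: MochizukiSemiAnbd2006, Ex 3.10 p.43] -/
theorem not_compactSpace_of_continuous_surjective_int {X : Type*} [TopologicalSpace X]
    (f : X → Multiplicative ℤ) (hf : Continuous f) (hs : Function.Surjective f) :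
    ¬ CompactSpace X := by
  intro hX
  have hc : IsCompact (Set.univ : Set (Multiplicative ℤ)) := by
    rw [← hs.range_eq]; exact isCompact_range hf
  haveI : CompactSpace (Multiplicative ℤ) := isCompact_univ_iff.mp hc
  haveI : Finite (Multiplicative ℤ) := finite_of_compact_of_discrete
  haveI : Infinite (Multiplicative ℤ) := inferInstanceAs (Infinite ℤ)
  exact not_finite (Multiplicative ℤ)

end Literature.AnabelianGeometry.AbsoluteAnabelian.AbsTopI

/-! ### The fibre product `Γ = P ×_Z ℤ`: the compact slice is the co-free core of `Γ × 1` -/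

namespace Literature.AnabelianGeometry.SemiGraphs.TemperedFibreProduct

open Literature.AnabelianGeometry.AbsoluteAnabelian.AbsTopI

universe u v

variable {P : Type u} [Group P] [TopologicalSpace P] [IsTopologicalGroup P] [CompactSpace P]
variable {Z : Type v} [Group Z] [TopologicalSpace Z] [T2Space Z]
variable (e : P →ₜ* Z) (ι : Multiplicative ℤ →* Z)
variable (Γ : Subgroup (P × Multiplicative ℤ)) (hΓ : ∀ p, p ∈ Γ ↔ e p.1 = ι p.2)

omit [IsTopologicalGroup P] in
include hΓ in
/-- **The slice `Γ₀ = Ker(pr_ℤ : Γ → ℤ)` is compact**: its image in `P × ℤ` is the closed subset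
`{(x, 0) | e x = ι 0}` of the compact `P × {0}`. [cite: MochizukiSemiAnbd2006, Ex 3.10 p.43] -/
theorem isCompact_ker_snd :
    IsCompact ((((MonoidHom.snd P (Multiplicative ℤ)).comp Γ.subtype).ker : Subgroup Γ) : Set Γ) := by
  rw [Topology.IsEmbedding.subtypeVal.isCompact_iff]
  have hset : Subtype.val '' ((((MonoidHom.snd P (Multiplicative ℤ)).comp Γ.subtype).ker :
      Subgroup Γ) : Set Γ) =
      ((fun q : P × Multiplicative ℤ => e q.1) ⁻¹' {ι 1}) ∩ (Prod.snd ⁻¹' {1}) := by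
    ext q
    constructor
    · rintro ⟨γ, hγ, rfl⟩
      have h2 : (γ : P × Multiplicative ℤ).2 = 1 := hγ
      refine ⟨?_, h2⟩
      change e (γ : P × Multiplicative ℤ).1 ∈ ({ι 1} : Set Z)
      rw [Set.mem_singleton_iff, (hΓ _).mp γ.2, h2]
    · rintro ⟨h1, h2⟩
      have h2' : q.2 = 1 := h2
      have hq : q ∈ Γ := (hΓ q).mpr (by rw [h2']; exact h1)
      exact ⟨⟨q, hq⟩, h2', rfl⟩
  rw [hset]
  have hK : IsCompact ((Set.univ : Set P) ×ˢ ({1} : Set (Multiplicative ℤ))) :=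
    isCompact_univ.prod isCompact_singleton
  refine hK.of_isClosed_subset ?_ ?_
  · exact ((isClosed_singleton.preimage (e.continuous.comp continuous_fst))).inter
      (isClosed_singleton.preimage continuous_snd)
  · rintro q ⟨-, h2⟩
    exact ⟨Set.mem_univ _, h2⟩

variable {G : Type*} [Group G] [TopologicalSpace G] [IsTopologicalGroup G]

include hΓ in
/-- **`(Γ × 1)^{co-fr} = Γ₀ × 1` inside `Γ × G`** ([AbsTopI] §0 p. 8): the compact slice `Γ₀ × 1`
(`Γ₀ = Ker(pr_ℤ)`) is co-free in `Δ := Γ × 1` — open, normal, with quotient `≅ ℤ` free (`pr_ℤ` onto)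
— and compact, hence the MINIMAL co-free subgroup (`isMinimalCofreeIn_of_isCompact`); in particular
of infinite index in `Δ`. [cite: MochizukiAbsTopI2012, §0 p.8] -/
theorem cofreeCore_top_prod_bot
    (hsurj : Function.Surjective ((MonoidHom.snd P (Multiplicative ℤ)).comp Γ.subtype)) :
    cofreeCore ((⊤ : Subgroup Γ).prod (⊥ : Subgroup G)) =
      ((((MonoidHom.snd P (Multiplicative ℤ)).comp Γ.subtype).ker).prod (⊥ : Subgroup G)) := by
  classical
  set K : Subgroup Γ := ((MonoidHom.snd P (Multiplicative ℤ)).comp Γ.subtype).ker with hKdef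
  set Δ : Subgroup (Γ × G) := (⊤ : Subgroup Γ).prod (⊥ : Subgroup G) with hΔdef
  set C : Subgroup (Γ × G) := K.prod (⊥ : Subgroup G) with hCdef
  have hmemΔ : ∀ x : Γ × G, x ∈ Δ ↔ x.2 = 1 := fun x => by
    simp [hΔdef, Subgroup.mem_prod]
  have hmemK : ∀ γ : Γ, γ ∈ K ↔ (γ : P × Multiplicative ℤ).2 = 1 := fun γ => MonoidHom.mem_ker
  have hmemC : ∀ x : Γ × G, x ∈ C ↔ (x.1 : P × Multiplicative ℤ).2 = 1 ∧ x.2 = 1 := fun x => by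
    rw [hCdef, Subgroup.mem_prod, hmemK, Subgroup.mem_bot]
  have hCΔ : C ≤ Δ := fun x hx => (hmemΔ x).2 ((hmemC x).1 hx).2
  -- compactness of `C = K × 1`
  have hCc : IsCompact (C : Set (Γ × G)) := by
    rw [hCdef, Subgroup.coe_prod, Subgroup.coe_bot]
    exact (isCompact_ker_snd e ι Γ hΓ).prod isCompact_singleton
  -- `C` is co-free in `Δ`
  haveI : K.Normal := MonoidHom.normal_ker _
  haveI : C.Normal := Subgroup.prod_normal K ⊥
  haveI hCn : (C.subgroupOf Δ).Normal := inferInstance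
  -- the `ℤ`-coordinate on `Δ`
  let ψ : Δ →* Multiplicative ℤ :=
    (((MonoidHom.snd P (Multiplicative ℤ)).comp Γ.subtype).comp (MonoidHom.fst Γ G)).comp Δ.subtype
  have hψ : ∀ δ : Δ, ψ δ = ((δ : Γ × G).1 : P × Multiplicative ℤ).2 := fun _ => rfl
  have hψs : Function.Surjective ψ := fun n => by
    obtain ⟨γ, hγ⟩ := hsurj n
    exact ⟨⟨(γ, 1), (hmemΔ _).2 rfl⟩, hγ⟩
  have hψker : ψ.ker = C.subgroupOf Δ := by
    ext δ
    rw [MonoidHom.mem_ker, hψ, Subgroup.mem_subgroupOf, hmemC]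
    exact ⟨fun h => ⟨h, (hmemΔ _).1 δ.2⟩, fun h => h.1⟩
  have hopen : IsOpen ((C.subgroupOf Δ : Subgroup Δ) : Set Δ) := by
    have hset : ((C.subgroupOf Δ : Subgroup Δ) : Set Δ) = (fun δ : Δ => (δ : Γ × G).1) ⁻¹' (K : Set Γ) := by
      ext δ
      rw [SetLike.mem_coe, Subgroup.mem_subgroupOf, hmemC, Set.mem_preimage, SetLike.mem_coe, hmemK]
      exact ⟨fun h => h.1, fun h => ⟨h, (hmemΔ _).1 δ.2⟩⟩
    rw [hset]
    exact (isOpen_ker_snd Γ).preimage (continuous_fst.comp continuous_subtype_val)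
  have hfree : IsFreeGroup (Δ ⧸ C.subgroupOf Δ) := by
    haveI : IsFreeGroup (Multiplicative ℤ) :=
      IsFreeGroup.ofMulEquiv (FreeGroup.mulEquivIntOfUnique (α := Unit))
    exact IsFreeGroup.ofMulEquiv
      ((QuotientGroup.quotientKerEquivOfSurjective ψ hψs).symm.trans
        (QuotientGroup.quotientMulEquivOfEq hψker))
  have hcof : IsCofreeIn Δ C := ⟨hCΔ, hCn, ⟨hopen, hfree⟩⟩
  exact cofreeCore_eq_of_isCofreeIn_of_isCompact hcof hCc

end Literature.AnabelianGeometry.SemiGraphs.TemperedFibreProduct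

end
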